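import Mathlib.Analysis.ODE.Gronwall
import Mathlib.Analysis.SpecialFunctions.Pow.Real
import Mathlib.MeasureTheory.Integral.IntervalIntegral.FundThmCalculus
import Mathlib.MeasureTheory.Integral.IntervalIntegral.IntegrationByParts
import HarnessLib

/-!
# Tao (2011/2013), proof of Thm. 10.1 (enstrophy localisation): the continuity-method step

A proved brick of the printed proof of Tao 2011, **Thm. 10.1** (arXiv:1108.1165, §10, proof of
"Theorem 59", last paragraph of p. 33), isolated as pure real analysis. Having bounded the six
terms `Y₁, …, Y₆` of the enstrophy identity `∂ₜW = -Y₁ - Y₂ + Y₃ + Y₄ + Y₅ + Y₆`, Tao arrives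
at the differential inequality

`∂ₜW ≤ -Y₁ + O(c^{0.05} δ⁻¹ W^{1/2} Y₁ + c^{-0.15} δ³ W^{3/2} + c^{0.75} W/T + a(t) W^{1/2} + b(t))`

for the localised enstrophy `W(t) ≥ 0` (`C¹` in `t`), with `Y₁ ≥ 0`, `∫₀ᵀ a ≲ δ` ((10.1)),
`∫₀ᵀ b ≲ δ²` (the pigeonholed heat-flux bound), `W(0) ≲ δ²` and the smallness `δ⁴T ≤ c`
((10.2)), and concludes by "the continuity method": under the bootstrap hypothesis
`sup_{[0,T']} W ≤ c^{-0.01}δ²` the first term is absorbed by `-Y₁`, the second and third are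
`O(W/T)`, the fourth is `O(c^{-0.005} δ a(t))`, so Grönwall gives
`sup_{[0,T']} W ≲ c^{-0.005}δ²`, which for `c` small beats the bootstrap hypothesis; hence
`sup_{[0,T]} W ≲ c^{-0.005} δ²`. This file **proves** exactly this step:

* `NS.bootstrap_gronwall` — the abstract continuity method: if `W ≥ 0` is continuous on
  `[0, T]` with right derivative `D`, `g ≥ 0` is continuous, `D ≤ κW + g` holds at every time at
  which `W ≤ B`, and the Grönwall bound `e^{κT}(W(0) + ∫₀ᵀ g)` is `< B`, then `W` obeys the
  Grönwall bound on all of `[0, T]` (first bad time + Mathlib's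
  `le_gronwallBound_of_liminf_deriv_right_le` applied to `W - ∫₀ᵗ g`);
* `NS.tao2011_enstrophy_continuity_step` — Tao's instance with his exponents: for every
  implied constant `K ≥ 1` there is an absolute `c₀ ∈ (0, 1]` such that for `0 < c ≤ c₀`,
  `δ⁴T ≤ c`, the displayed differential inequality (constant `K`), `W(0) ≤ Kδ²`, `∫₀ᵀ a ≤ Kδ`,
  `∫₀ᵀ b ≤ Kδ²` imply `W(t) ≤ 3K²e^{2K} c^{-1/200} δ²` on `[0, T]` (the `L^∞_t L²_x` half of the
  conclusion of Thm. 10.1), and — integrating the absorbed inequality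
  `∂ₜW ≤ -½Y₁ + 2KW/T + K(c^{-0.005}δa + b)` once more — the dissipation bound
  `∫₀ᵀ Y₁ dt ≤ 18K³e^{2K} c^{-1/200} δ²` (the `L²_t L²_x` half, `‖∇ω‖_{L²_t L²_x} ≲ δ`, which the
  printed proof leaves implicit in "it will suffice to show that `W(t) ≲_c δ²`").

* `NS.bootstrap_gronwall_integral`, `NS.tao2011_enstrophy_continuity_step_integral` — the same
  two statements for the **integrated** inequality `W(t) + ∫₀ᵗ Y₁ ≤ W(0) + ∫₀ᵗ (…)` (no
  derivative of `W`), which is the form in which §10 delivers the enstrophy inequality: the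
  radius `R'(t) = R' − c⁻¹∫₀ᵗ‖u(s)‖_{L^∞_x} ds` is only absolutely continuous (the speed is
  merely integrable, Prop. 9.1), so `W` need not be differentiable; the pointwise absorption is
  isolated as `NS.tao2011_absorb`.

Regularity conventions: `W` continuous on `[0, T]` (with a right derivative at each
`t ∈ [0, T)` in the differential form; Tao: "As `u` is almost smooth, `W` is `C¹_t`"), `a`, `b`
continuous on `[0, T]` (in §10, `a(t) = ‖∇ × f(t)‖_{L²(B(0,R))}` and `b(t)` is a
boundary/annulus integral of the smooth `ω`, both continuous), `Y = Y₁ ≥ 0`, continuous on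
`[0, T]` where it is integrated (in §10, `Y₁(t) = ∫|∇ω(t)|²η(t)` is continuous).

## Mathlib search

`gronwallBound`, `le_gronwallBound_of_liminf_deriv_right_le` (scalar Grönwall with right
derivatives), `intervalIntegral.integral_hasDerivWithinAt_right` (FTC for `∫₀ᵗ g`),
`IsClosed.csInf_mem` (first bad time); no bootstrap/continuity-method lemma exists in Mathlib
or the tree (`lean search 'bootstrap|continuity method'`).

## References

* T. Tao, *Localisation and compactness properties of the Navier–Stokes global regularity
  problem*, Anal. PDE 6 (2013) 25–107 = arXiv:1108.1165 (`Tao2011`), §10, proof of Thm. 10.1,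
  from "collecting the bounds for `Y₁, …, Y₆`" to "The proof of Theorem 10.1 is now complete"
  (arXiv p. 33).
-/

noncomputable section

open MeasureTheory Set Filter Topology intervalIntegral

namespace Literature.Analysis.FluidPDE

/-! ## The abstract continuity method -/

/-- **Continuity method with Grönwall's inequality.** Let `W` be continuous on `[0, T]` with
right derivative `D t` at every `t ∈ [0, T)`, `W(0) ≥ 0`, and let `g ≥ 0` be continuous on
`[0, T]`, `κ > 0`. Suppose the differential inequality `D t ≤ κ W t + g t` holds at every
`t ∈ [0, T)` at which the bootstrap hypothesis `W t ≤ B` holds, and that the Grönwall bound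
`M = e^{κT}(W(0) + ∫₀ᵀ g)` satisfies `M < B`. Then `W t ≤ M` for all `t ∈ [0, T]`. Proof: at the
first time `t₁` with `W t₁ ≥ B` (if any) the inequality holds on `[0, t₁)`, so Grönwall applied to
`W - ∫₀ᵗ g` gives `W t₁ ≤ M < B`, a contradiction; hence `W < B` throughout and Grönwall applies
on `[0, T]`. [cite: Tao2011, §10, proof of Thm. 10.1 (continuity method)] -/
theorem bootstrap_gronwall {T κ B : ℝ} (hT : 0 < T) (hκ : 0 < κ) {W D g : ℝ → ℝ}
    (hW : ContinuousOn W (Icc 0 T)) (hD : ∀ t ∈ Ico 0 T, HasDerivWithinAt W (D t) (Ici t) t)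
    (hg : ContinuousOn g (Icc 0 T)) (hg0 : ∀ t ∈ Icc 0 T, 0 ≤ g t) (hW0 : 0 ≤ W 0)
    (hineq : ∀ t ∈ Ico 0 T, W t ≤ B → D t ≤ κ * W t + g t)
    (hM : Real.exp (κ * T) * (W 0 + ∫ s in (0)..T, g s) < B) :
    ∀ t ∈ Icc 0 T, W t ≤ Real.exp (κ * T) * (W 0 + ∫ s in (0)..T, g s) := by
  set Γ : ℝ := ∫ s in (0)..T, g s with hΓ
  -- the primitive of `g`
  set G : ℝ → ℝ := fun t => ∫ s in (0)..t, g s with hG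
  have hgi : IntervalIntegrable g volume 0 T := hg.intervalIntegrable_of_Icc hT.le
  have hgint : IntegrableOn g (uIcc 0 T) volume := by
    rw [uIcc_of_le hT.le]
    exact hg.integrableOn_compact isCompact_Icc
  have hGc : ContinuousOn G (Icc 0 T) := by
    have := continuousOn_primitive_interval (μ := volume) hgint
    rwa [uIcc_of_le hT.le] at this
  have hG0 : G 0 = 0 := by simp [hG]
  have hΓ0 : 0 ≤ Γ := intervalIntegral.integral_nonneg hT.le fun s hs => hg0 s hs
  have hg_ae : 0 ≤ᵐ[volume.restrict (Ioc 0 T)] g :=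
    (ae_restrict_iff' measurableSet_Ioc).2 (Eventually.of_forall fun s hs =>
      hg0 s (Ioc_subset_Icc_self hs))
  have hGle : ∀ t ∈ Icc 0 T, G t ≤ Γ := fun t ht =>
    integral_mono_interval le_rfl ht.1 ht.2 hg_ae hgi
  have hGd : ∀ t ∈ Ico 0 T, HasDerivWithinAt G (g t) (Ici t) t := by
    intro t ht
    have hIcc : Icc 0 T ∈ 𝓝[>] t :=
      mem_of_superset (Icc_mem_nhdsGT ht.2) (Icc_subset_Icc ht.1 le_rfl)
    have hmeas : StronglyMeasurableAtFilter g (𝓝[>] t) volume :=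
      (hg.stronglyMeasurableAtFilter_nhdsWithin measurableSet_Icc t).filter_mono
        (nhdsWithin_le_iff.2 hIcc)
    have hcont : ContinuousWithinAt g (Ioi t) t :=
      (hg t ⟨ht.1, ht.2.le⟩).mono_of_mem_nhdsWithin hIcc
    exact integral_hasDerivWithinAt_right (hgi.mono_set (by
      rw [uIcc_of_le hT.le, uIcc_of_le ht.1]; exact Icc_subset_Icc le_rfl ht.2.le)) hmeas hcont
  -- Grönwall under the bootstrap hypothesis on `[0, t₁)`
  have claim : ∀ t₁ ∈ Icc 0 T, (∀ t ∈ Ico 0 t₁, W t ≤ B) →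
      ∀ t ∈ Icc 0 t₁, W t ≤ Real.exp (κ * T) * (W 0 + Γ) := by
    intro t₁ ht₁ hB t ht
    set f : ℝ → ℝ := fun s => W s - G s with hf
    have hfc : ContinuousOn f (Icc 0 t₁) :=
      (hW.mono (Icc_subset_Icc le_rfl ht₁.2)).sub (hGc.mono (Icc_subset_Icc le_rfl ht₁.2))
    have hf' : ∀ s ∈ Ico 0 t₁, HasDerivWithinAt f (D s - g s) (Ici s) s := fun s hs =>
      (hD s ⟨hs.1, hs.2.trans_le ht₁.2⟩).sub (hGd s ⟨hs.1, hs.2.trans_le ht₁.2⟩)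
    have hbound : ∀ s ∈ Ico 0 t₁, D s - g s ≤ κ * f s + κ * Γ := by
      intro s hs
      have h1 := hineq s ⟨hs.1, hs.2.trans_le ht₁.2⟩ (hB s hs)
      have h2 : G s ≤ Γ := hGle s ⟨hs.1, (hs.2.trans_le ht₁.2).le⟩
      have h3 : κ * G s ≤ κ * Γ := mul_le_mul_of_nonneg_left h2 hκ.le
      simp only [hf]
      nlinarith
    have hgr := le_gronwallBound_of_liminf_deriv_right_le hfc
      (fun s hs r hr => (hf' s hs).liminf_right_slope_le hr) (by simp [hf, hG] : f 0 ≤ W 0)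
      hbound t ht
    rw [gronwallBound_of_K_ne_0 hκ.ne', sub_zero] at hgr
    have hexp : Real.exp (κ * t) ≤ Real.exp (κ * T) :=
      Real.exp_le_exp.2 (mul_le_mul_of_nonneg_left (ht.2.trans ht₁.2) hκ.le)
    have hGt : G t ≤ Γ := hGle t ⟨ht.1, ht.2.trans ht₁.2⟩
    have hft : W t = f t + G t := by simp [hf]
    have hkey : κ * Γ / κ = Γ := by field_simp
    simp only [hkey] at hgr
    -- hgr : f t ≤ W 0 * exp (κ t) + Γ * (exp (κ t) - 1)
    rw [hft]
    have h1 : 1 ≤ Real.exp (κ * t) := Real.one_le_exp (mul_nonneg hκ.le ht.1)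
    nlinarith [mul_le_mul_of_nonneg_left hexp hW0, mul_le_mul_of_nonneg_left hexp hΓ0]
  -- the first bad time, if any
  by_cases hA : ∃ t ∈ Icc 0 T, B ≤ W t
  · exfalso
    set A : Set ℝ := Icc 0 T ∩ W ⁻¹' Ici B with hAdef
    have hAc : IsClosed A := hW.preimage_isClosed_of_isClosed isClosed_Icc isClosed_Ici
    have hAne : A.Nonempty := by
      obtain ⟨t, ht, hBt⟩ := hA
      exact ⟨t, ht, hBt⟩
    have hAbdd : BddBelow A := ⟨0, fun t ht => ht.1.1⟩
    have ht₁A : sInf A ∈ A := hAc.csInf_mem hAne hAbdd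
    have ht₁ : sInf A ∈ Icc 0 T := ht₁A.1
    have hlt : ∀ t ∈ Ico 0 (sInf A), W t ≤ B := by
      intro t ht
      by_contra hcon
      have htA : t ∈ A := ⟨⟨ht.1, (ht.2.le.trans ht₁.2)⟩, (not_le.1 hcon).le⟩
      exact absurd (csInf_le hAbdd htA) (not_le.2 ht.2)
    have h1 := claim (sInf A) ht₁ hlt (sInf A) ⟨ht₁.1, le_rfl⟩
    have h2 : B ≤ W (sInf A) := ht₁A.2
    linarith
  · push Not at hA
    exact claim T ⟨hT.le, le_rfl⟩ (fun t ht => (hA t ⟨ht.1, ht.2.le⟩).le)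

/-! ## Tao's instance -/

/-- Square roots under the bootstrap hypothesis: `W ≤ β²`, `β ≥ 0` gives `√W ≤ β`. [folklore] -/
theorem sqrt_le_of_le_sq {W β : ℝ} (hβ : 0 ≤ β) (h : W ≤ β ^ 2) : Real.sqrt W ≤ β := by
  calc Real.sqrt W ≤ Real.sqrt (β ^ 2) := Real.sqrt_le_sqrt h
    _ = β := Real.sqrt_sq hβ

/-- FTC for the primitive `t ↦ ∫₀ᵗ φ` of a function continuous on `[0, T]`: it is continuous on
`[0, T]` and has right derivative `φ t` at every `t ∈ [0, T)`. [folklore] -/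
theorem primitive_continuousOn_hasDerivWithinAt {T : ℝ} (hT : 0 < T) {φ : ℝ → ℝ}
    (hφ : ContinuousOn φ (Icc 0 T)) :
    ContinuousOn (fun t => ∫ s in (0)..t, φ s) (Icc 0 T) ∧
      ∀ t ∈ Ico 0 T, HasDerivWithinAt (fun t => ∫ s in (0)..t, φ s) (φ t) (Ici t) t := by
  have hφi : IntervalIntegrable φ volume 0 T := hφ.intervalIntegrable_of_Icc hT.le
  have hφint : IntegrableOn φ (uIcc 0 T) volume := by
    rw [uIcc_of_le hT.le]
    exact hφ.integrableOn_compact isCompact_Icc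
  refine ⟨?_, ?_⟩
  · have := continuousOn_primitive_interval (μ := volume) hφint
    rwa [uIcc_of_le hT.le] at this
  · intro t ht
    have hIcc : Icc 0 T ∈ 𝓝[>] t :=
      mem_of_superset (Icc_mem_nhdsGT ht.2) (Icc_subset_Icc ht.1 le_rfl)
    have hmeas : StronglyMeasurableAtFilter φ (𝓝[>] t) volume :=
      (hφ.stronglyMeasurableAtFilter_nhdsWithin measurableSet_Icc t).filter_mono
        (nhdsWithin_le_iff.2 hIcc)
    have hcont : ContinuousWithinAt φ (Ioi t) t :=
      (hφ t ⟨ht.1, ht.2.le⟩).mono_of_mem_nhdsWithin hIcc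
    exact integral_hasDerivWithinAt_right (hφi.mono_set (by
      rw [uIcc_of_le hT.le, uIcc_of_le ht.1]; exact Icc_subset_Icc le_rfl ht.2.le)) hmeas hcont

/-- **Monotonicity from a nonpositive right derivative** (the `κ = 0` case of Grönwall): if `Φ`
is continuous on `[0, T]` with right derivative `Ψ t ≤ 0` at every `t ∈ [0, T)`, then
`Φ T ≤ Φ 0`. [folklore] -/
theorem le_init_of_deriv_right_nonpos {T : ℝ} (hT : 0 < T) {Φ Ψ : ℝ → ℝ}
    (hΦ : ContinuousOn Φ (Icc 0 T)) (hΨ : ∀ t ∈ Ico 0 T, HasDerivWithinAt Φ (Ψ t) (Ici t) t)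
    (hneg : ∀ t ∈ Ico 0 T, Ψ t ≤ 0) : Φ T ≤ Φ 0 := by
  have hgr := le_gronwallBound_of_liminf_deriv_right_le (δ := Φ 0) (K := 0) (ε := 0) hΦ
    (fun s hs r hr => (hΨ s hs).liminf_right_slope_le hr) le_rfl
    (fun t ht => by simpa using hneg t ht) T ⟨hT.le, le_rfl⟩
  simpa [gronwallBound_K0] using hgr
set_option maxHeartbeats 400000 in -- buildfix (bf3-g26): 160k/180k FAIL, 200k PASS at accept time; line-neutral budget line
/-- **Tao 2011, proof of Thm. 10.1 — the continuity-method step, with Tao's exponents.** For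
every implied constant `K ≥ 1` there is `c₀ ∈ (0, 1]` (depending only on `K`) such that the
following holds for all `0 < c ≤ c₀`, `δ, T > 0` with `δ⁴T ≤ c` (from (10.2)). Let `W ≥ 0` be
continuous on `[0, T]` with right derivative `D t` at each `t ∈ [0, T)`, let `Y ≥ 0` on
`[0, T)`, let `a, b ≥ 0` be continuous on `[0, T]`, and assume `W(0) ≤ Kδ²` ((10.1) via
`W(0) ≲ δ²`), `∫₀ᵀ a ≤ Kδ` (`∫₀ᵀ a(t) dt ≲ δ`), `∫₀ᵀ b ≤ Kδ²` (the pigeonholed bound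
`∫₀ᵀ b(t) dt ≲ δ²`) and the differential inequality
`D t ≤ -Y t + K(c^{0.05} δ⁻¹ W^{1/2} Y + c^{-0.15} δ³ W^{3/2} + c^{0.75} W/T + a W^{1/2} + b)`
on `[0, T)` (Tao's "`∂ₜW ≤ -Y₁ + O(…)`", `W^{3/2}` written `W·W^{1/2}`). Then
(i) `W t ≤ 3K²e^{2K} c^{-0.005} δ²` for all `t ∈ [0, T]` (Tao: "`sup_{t ∈ [0,T]} W(t) ≲ c^{-0.005}δ²`"),
and (ii) if moreover `Y` is continuous on `[0, T]`, `∫₀ᵀ Y dt ≤ 18K³e^{2K} c^{-0.005} δ²` (the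
`‖∇ω‖_{L²_t L²_x}` half of the conclusion of Thm. 10.1).
Proof as printed: under the bootstrap hypothesis `W ≤ c^{-0.01}δ²` one has `W^{1/2} ≤ c^{-0.005}δ`,
so the `Y`-term is at most `Kc^{0.045} Y ≤ ½Y` and is absorbed, `c^{-0.15}δ³W^{3/2} ≤ c^{-0.155}δ⁴W
≤ c^{0.845} W/T`, `aW^{1/2} ≤ c^{-0.005}δa`; Grönwall (`bootstrap_gronwall` with `κ = 2K/T`,
`g = K(c^{-0.005}δa + b)`) gives `W ≤ e^{2K}(Kδ² + 2K²c^{-0.005}δ²) ≤ 3K²e^{2K}c^{-0.005}δ²`, which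
is `< c^{-0.01}δ²` once `3K²e^{2K} c^{0.005} < 1`; finally `t ↦ W + ½∫₀ᵗY - ∫₀ᵗ(2KW/T + g)` has
nonpositive right derivative, so `½∫₀ᵀ Y ≤ W(0) + 2K sup W + ∫₀ᵀ g`.
[cite: Tao2011, §10, proof of Thm. 10.1 (continuity method)] -/
theorem tao2011_enstrophy_continuity_step {K : ℝ} (hK : 1 ≤ K) :
    ∃ c₀ : ℝ, 0 < c₀ ∧ c₀ ≤ 1 ∧ ∀ ⦃c δ T : ℝ⦄, 0 < c → c ≤ c₀ → 0 < δ → 0 < T → δ ^ 4 * T ≤ c →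
    ∀ ⦃W D Y a b : ℝ → ℝ⦄, ContinuousOn W (Icc 0 T) →
      (∀ t ∈ Ico 0 T, HasDerivWithinAt W (D t) (Ici t) t) →
      ContinuousOn a (Icc 0 T) → ContinuousOn b (Icc 0 T) →
      (∀ t ∈ Icc 0 T, 0 ≤ W t) → (∀ t ∈ Ico 0 T, 0 ≤ Y t) →
      (∀ t ∈ Icc 0 T, 0 ≤ a t) → (∀ t ∈ Icc 0 T, 0 ≤ b t) →
      W 0 ≤ K * δ ^ 2 → (∫ t in (0)..T, a t) ≤ K * δ → (∫ t in (0)..T, b t) ≤ K * δ ^ 2 →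
      (∀ t ∈ Ico 0 T, D t ≤ -Y t + K * (c ^ (1 / 20 : ℝ) * δ⁻¹ * Real.sqrt (W t) * Y t +
          c ^ (-(3 / 20 : ℝ)) * δ ^ 3 * (W t * Real.sqrt (W t)) + c ^ (3 / 4 : ℝ) * W t / T +
          a t * Real.sqrt (W t) + b t)) →
      (∀ t ∈ Icc 0 T, W t ≤ 3 * K ^ 2 * Real.exp (2 * K) * c ^ (-(1 / 200 : ℝ)) * δ ^ 2) ∧
        (ContinuousOn Y (Icc 0 T) →
          (∫ t in (0)..T, Y t) ≤ 18 * K ^ 3 * Real.exp (2 * K) * c ^ (-(1 / 200 : ℝ)) * δ ^ 2) := by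
  -- the constant `L = 3K²e^{2K}` and the threshold `c₀ = (2L)^{-200}`
  set L : ℝ := 3 * K ^ 2 * Real.exp (2 * K) with hL
  have hK0 : 0 < K := one_pos.trans_le hK
  have hexp1 : 1 ≤ Real.exp (2 * K) := Real.one_le_exp (by positivity)
  have hK2L : 3 * K ^ 2 ≤ L := by
    rw [hL]
    nlinarith [mul_le_mul_of_nonneg_left hexp1 (by positivity : (0 : ℝ) ≤ 3 * K ^ 2)]
  have hKK : K ≤ K ^ 2 := by nlinarith
  have hLK : K ≤ L := by linarith [hKK, hK2L, sq_nonneg K]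
  have hL1 : 1 ≤ L := hK.trans hLK
  have hL0 : 0 < L := one_pos.trans_le hL1
  have h2L : 1 ≤ 2 * L := by linarith
  refine ⟨(2 * L) ^ (-(200 : ℝ)), Real.rpow_pos_of_pos (by positivity) _,
    Real.rpow_le_one_of_one_le_of_nonpos h2L (by norm_num), ?_⟩
  intro c δ T hc hcc₀ hδ hT hδT W D Y a b hWc hD hac hbc hW0' hY0 ha0 hb0 hW0 hIa hIb hineq
  -- `c ≤ 1` and the key smallness `c^{1/200} ≤ (2L)⁻¹`
  have hc1 : c ≤ 1 := hcc₀.trans (Real.rpow_le_one_of_one_le_of_nonpos h2L (by norm_num))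
  have hroot : c ^ (1 / 200 : ℝ) ≤ (2 * L)⁻¹ := by
    calc c ^ (1 / 200 : ℝ) ≤ ((2 * L) ^ (-(200 : ℝ))) ^ (1 / 200 : ℝ) :=
          Real.rpow_le_rpow hc.le hcc₀ (by norm_num)
      _ = (2 * L)⁻¹ := by
          rw [← Real.rpow_mul (by positivity), show (-(200 : ℝ)) * (1 / 200) = -1 by norm_num,
            Real.rpow_neg_one]
  have hroot0 : 0 < c ^ (1 / 200 : ℝ) := Real.rpow_pos_of_pos hc _
  -- `β = c^{-1/200} δ`, bootstrap level `B = β²`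
  set γ : ℝ := c ^ (-(1 / 200 : ℝ)) with hγ
  have hγinv : γ = (c ^ (1 / 200 : ℝ))⁻¹ := by rw [hγ, Real.rpow_neg hc.le]
  have hγ1 : 1 ≤ γ := Real.one_le_rpow_of_pos_of_le_one_of_nonpos hc hc1 (by norm_num)
  have hγ0 : 0 < γ := one_pos.trans_le hγ1
  have hLγ : L < γ := by
    rw [hγinv, lt_inv_comm₀ hL0 hroot0]
    calc c ^ (1 / 200 : ℝ) ≤ (2 * L)⁻¹ := hroot
      _ < L⁻¹ := by
          rw [inv_lt_inv₀ (by positivity) hL0]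
          linarith
  set β : ℝ := γ * δ with hβ
  have hβ0 : 0 < β := mul_pos hγ0 hδ
  -- exponent bookkeeping
  have hKc : K * c ^ (9 / 200 : ℝ) ≤ 1 / 2 := by
    have h9 : c ^ (9 / 200 : ℝ) = (c ^ (1 / 200 : ℝ)) ^ (9 : ℕ) := by
      rw [← Real.rpow_mul_natCast hc.le]; norm_num
    have h1 : c ^ (1 / 200 : ℝ) ≤ 1 := Real.rpow_le_one hc.le hc1 (by norm_num)
    have h2 : (c ^ (1 / 200 : ℝ)) ^ (9 : ℕ) ≤ c ^ (1 / 200 : ℝ) :=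
      pow_le_of_le_one hroot0.le h1 (by norm_num)
    have h3 : K * (2 * L)⁻¹ ≤ 1 / 2 := by
      rw [mul_inv_le_iff₀ (by positivity)]; linarith
    calc K * c ^ (9 / 200 : ℝ) ≤ K * c ^ (1 / 200 : ℝ) := by
          rw [h9]; exact mul_le_mul_of_nonneg_left h2 hK0.le
      _ ≤ K * (2 * L)⁻¹ := mul_le_mul_of_nonneg_left hroot hK0.le
      _ ≤ 1 / 2 := h3
  have hexpA : c ^ (1 / 20 : ℝ) * γ = c ^ (9 / 200 : ℝ) := by
    rw [hγ, ← Real.rpow_add hc]; norm_num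
  have hexpB : c ^ (-(3 / 20 : ℝ)) * γ * c ≤ 1 := by
    rw [hγ, ← Real.rpow_add hc, ← Real.rpow_add_one hc.ne']
    exact Real.rpow_le_one hc.le hc1 (by norm_num)
  have hexpC : c ^ (3 / 4 : ℝ) ≤ 1 := Real.rpow_le_one hc.le hc1 (by norm_num)
  have hδ4 : δ ^ 4 ≤ c / T := by rw [le_div_iff₀ hT]; exact hδT
  -- the absorbed inequality: `D ≤ -½Y + (2K/T) W + K(γ δ a + b)` whenever `W ≤ β²`
  have hineq'' : ∀ t ∈ Ico 0 T, W t ≤ β ^ 2 →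
      D t ≤ -(1 / 2) * Y t + 2 * K / T * W t + K * (γ * δ * a t + b t) := by
    intro t ht hWB
    have hWt : 0 ≤ W t := hW0' t ⟨ht.1, ht.2.le⟩
    have hs : Real.sqrt (W t) ≤ β := sqrt_le_of_le_sq hβ0.le hWB
    have hs0 : 0 ≤ Real.sqrt (W t) := Real.sqrt_nonneg _
    have hYt := hY0 t ht
    have hat := ha0 t ⟨ht.1, ht.2.le⟩
    have hbt := hb0 t ⟨ht.1, ht.2.le⟩
    have hDt := hineq t ht
    -- term 1: `K c^{1/20} δ⁻¹ √W Y ≤ K c^{9/200} Y ≤ ½Y`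
    have h1 : K * (c ^ (1 / 20 : ℝ) * δ⁻¹ * Real.sqrt (W t) * Y t) ≤ 1 / 2 * Y t := by
      have e1 : c ^ (1 / 20 : ℝ) * δ⁻¹ * Real.sqrt (W t) ≤ c ^ (9 / 200 : ℝ) := by
        calc c ^ (1 / 20 : ℝ) * δ⁻¹ * Real.sqrt (W t) ≤ c ^ (1 / 20 : ℝ) * δ⁻¹ * β :=
              mul_le_mul_of_nonneg_left hs (by positivity)
          _ = c ^ (9 / 200 : ℝ) := by
              rw [hβ, ← hexpA]; field_simp
      calc K * (c ^ (1 / 20 : ℝ) * δ⁻¹ * Real.sqrt (W t) * Y t)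
          = K * (c ^ (1 / 20 : ℝ) * δ⁻¹ * Real.sqrt (W t)) * Y t := by ring
        _ ≤ K * c ^ (9 / 200 : ℝ) * Y t := by
            have := mul_le_mul_of_nonneg_left e1 hK0.le
            exact mul_le_mul_of_nonneg_right (by linarith) hYt
        _ ≤ 1 / 2 * Y t := mul_le_mul_of_nonneg_right hKc hYt
    -- term 2: `K c^{-3/20} δ³ W √W ≤ K c^{-3/20} γ δ⁴ W ≤ K c^{-3/20} γ c W / T ≤ K W / T`
    have h2 : K * (c ^ (-(3 / 20 : ℝ)) * δ ^ 3 * (W t * Real.sqrt (W t))) ≤ K * W t / T := by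
      have e1 : W t * Real.sqrt (W t) ≤ W t * β := mul_le_mul_of_nonneg_left hs hWt
      have e2 : c ^ (-(3 / 20 : ℝ)) * δ ^ 3 * (W t * β) =
          (c ^ (-(3 / 20 : ℝ)) * γ) * δ ^ 4 * W t := by rw [hβ]; ring
      have hcg : 0 ≤ c ^ (-(3 / 20 : ℝ)) * γ := by positivity
      have e3 : (c ^ (-(3 / 20 : ℝ)) * γ) * δ ^ 4 * W t ≤ (c ^ (-(3 / 20 : ℝ)) * γ) * (c / T) * W t :=
        mul_le_mul_of_nonneg_right (mul_le_mul_of_nonneg_left hδ4 hcg) hWt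
      have e4 : (c ^ (-(3 / 20 : ℝ)) * γ) * (c / T) * W t = (c ^ (-(3 / 20 : ℝ)) * γ * c) * (W t / T) := by
        ring
      have e5 : (c ^ (-(3 / 20 : ℝ)) * γ * c) * (W t / T) ≤ 1 * (W t / T) :=
        mul_le_mul_of_nonneg_right hexpB (div_nonneg hWt hT.le)
      calc K * (c ^ (-(3 / 20 : ℝ)) * δ ^ 3 * (W t * Real.sqrt (W t)))
          ≤ K * (c ^ (-(3 / 20 : ℝ)) * δ ^ 3 * (W t * β)) :=
            mul_le_mul_of_nonneg_left (mul_le_mul_of_nonneg_left e1 (by positivity)) hK0.le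
        _ ≤ K * (1 * (W t / T)) := by
            rw [e2]
            exact mul_le_mul_of_nonneg_left (e3.trans (by rw [e4]; exact e5)) hK0.le
        _ = K * W t / T := by ring
    -- term 3: `K c^{3/4} W / T ≤ K W / T`
    have h3 : K * (c ^ (3 / 4 : ℝ) * W t / T) ≤ K * W t / T := by
      have : c ^ (3 / 4 : ℝ) * W t / T ≤ 1 * W t / T := by
        rw [mul_div_assoc, mul_div_assoc]
        exact mul_le_mul_of_nonneg_right hexpC (div_nonneg hWt hT.le)
      calc K * (c ^ (3 / 4 : ℝ) * W t / T) ≤ K * (1 * W t / T) := mul_le_mul_of_nonneg_left this hK0.le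
        _ = K * W t / T := by ring
    -- term 4: `K a √W ≤ K γ δ a`
    have h4 : K * (a t * Real.sqrt (W t)) ≤ K * (γ * δ * a t) := by
      refine mul_le_mul_of_nonneg_left ?_ hK0.le
      calc a t * Real.sqrt (W t) ≤ a t * β := mul_le_mul_of_nonneg_left hs hat
        _ = γ * δ * a t := by rw [hβ]; ring
    have hsum : K * (c ^ (1 / 20 : ℝ) * δ⁻¹ * Real.sqrt (W t) * Y t +
        c ^ (-(3 / 20 : ℝ)) * δ ^ 3 * (W t * Real.sqrt (W t)) + c ^ (3 / 4 : ℝ) * W t / T +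
        a t * Real.sqrt (W t) + b t) ≤
        1 / 2 * Y t + K * W t / T + K * W t / T + K * (γ * δ * a t) + K * b t := by
      have := add_le_add (add_le_add (add_le_add (add_le_add h1 h2) h3) h4) (le_refl (K * b t))
      linarith [this]
    have hKWT : K * W t / T = K / T * W t := by ring
    calc D t ≤ -Y t + K * (c ^ (1 / 20 : ℝ) * δ⁻¹ * Real.sqrt (W t) * Y t +
          c ^ (-(3 / 20 : ℝ)) * δ ^ 3 * (W t * Real.sqrt (W t)) + c ^ (3 / 4 : ℝ) * W t / T +
          a t * Real.sqrt (W t) + b t) := hDt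
      _ ≤ -Y t + (1 / 2 * Y t + K * W t / T + K * W t / T + K * (γ * δ * a t) + K * b t) := by
          linarith [hsum]
      _ = -(1 / 2) * Y t + 2 * K / T * W t + K * (γ * δ * a t + b t) := by
          rw [hKWT]
          ring
  have hineq' : ∀ t ∈ Ico 0 T, W t ≤ β ^ 2 →
      D t ≤ 2 * K / T * W t + K * (γ * δ * a t + b t) := by
    intro t ht hWB
    have h1 := hineq'' t ht hWB
    have h2 := hY0 t ht
    linarith
  -- the forcing `g = K(γ δ a + b)`: continuity, sign, integral
  set g : ℝ → ℝ := fun t => K * (γ * δ * a t + b t) with hgdef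
  have hgc : ContinuousOn g (Icc 0 T) :=
    continuousOn_const.mul ((continuousOn_const.mul hac).add hbc)
  have hg0 : ∀ t ∈ Icc 0 T, 0 ≤ g t := fun t ht => by
    have := ha0 t ht; have := hb0 t ht; positivity
  have hai : IntervalIntegrable a volume 0 T := hac.intervalIntegrable_of_Icc hT.le
  have hbi : IntervalIntegrable b volume 0 T := hbc.intervalIntegrable_of_Icc hT.le
  have hIg : ∫ t in (0)..T, g t = K * (γ * δ * (∫ t in (0)..T, a t) + ∫ t in (0)..T, b t) := by
    simp only [hgdef]
    rw [intervalIntegral.integral_const_mul, intervalIntegral.integral_add (hai.const_mul _) hbi,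
      intervalIntegral.integral_const_mul]
  have hIg_le : ∫ t in (0)..T, g t ≤ 2 * K ^ 2 * γ * δ ^ 2 := by
    rw [hIg]
    have e1 : γ * δ * (∫ t in (0)..T, a t) ≤ γ * δ * (K * δ) :=
      mul_le_mul_of_nonneg_left hIa (by positivity)
    have e2 : K * δ ^ 2 ≤ K * δ ^ 2 * γ := le_mul_of_one_le_right (by positivity) hγ1
    nlinarith [mul_le_mul_of_nonneg_left (add_le_add e1 hIb) hK0.le]
  -- the Grönwall bound and the comparison with the bootstrap level
  have hκ : 0 < 2 * K / T := by positivity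
  have hκT : 2 * K / T * T = 2 * K := by field_simp
  have hMle : Real.exp (2 * K / T * T) * (W 0 + ∫ t in (0)..T, g t) ≤ L * γ * δ ^ 2 := by
    rw [hκT, hL]
    have e1 : W 0 + ∫ t in (0)..T, g t ≤ 3 * K ^ 2 * γ * δ ^ 2 := by
      have e2 : K * δ ^ 2 ≤ K ^ 2 * γ * δ ^ 2 := by
        have : K ≤ K ^ 2 * γ := by nlinarith [mul_le_mul hK hγ1 zero_le_one hK0.le]
        exact mul_le_mul_of_nonneg_right this (by positivity)
      linarith [hW0, hIg_le]
    calc Real.exp (2 * K) * (W 0 + ∫ t in (0)..T, g t)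
        ≤ Real.exp (2 * K) * (3 * K ^ 2 * γ * δ ^ 2) :=
          mul_le_mul_of_nonneg_left e1 (Real.exp_pos _).le
      _ = 3 * K ^ 2 * Real.exp (2 * K) * γ * δ ^ 2 := by ring
  have hLγδ : L * γ * δ ^ 2 < β ^ 2 := by
    rw [hβ, mul_pow, sq γ]
    exact mul_lt_mul_of_pos_right (mul_lt_mul_of_pos_right hLγ hγ0) (pow_pos hδ 2)
  have hMlt : Real.exp (2 * K / T * T) * (W 0 + ∫ t in (0)..T, g t) < β ^ 2 :=
    hMle.trans_lt hLγδ
  have hW00 : 0 ≤ W 0 := hW0' 0 ⟨le_rfl, hT.le⟩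
  -- (i) the sup bound
  have hsup : ∀ t ∈ Icc 0 T, W t ≤ L * γ * δ ^ 2 := fun t ht =>
    (bootstrap_gronwall hT hκ hWc hD hgc hg0 hW00 hineq' hMlt t ht).trans hMle
  refine ⟨fun t ht => (hsup t ht).trans_eq (by rw [hL, hγ]), fun hYc => ?_⟩
  -- (ii) the dissipation bound: `Φ = W + ½∫₀ᵗY - ∫₀ᵗ(2KW/T + g)` has right derivative `≤ 0`
  set h : ℝ → ℝ := fun t => 2 * K / T * W t + g t with hhdef
  have hhc : ContinuousOn h (Icc 0 T) := (continuousOn_const.mul hWc).add hgc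
  obtain ⟨hIYc, hIYd⟩ := primitive_continuousOn_hasDerivWithinAt hT hYc
  obtain ⟨hIhc, hIhd⟩ := primitive_continuousOn_hasDerivWithinAt hT hhc
  set Φ : ℝ → ℝ := fun t => W t + 1 / 2 * (∫ s in (0)..t, Y s) - ∫ s in (0)..t, h s with hΦdef
  have hΦc : ContinuousOn Φ (Icc 0 T) := (hWc.add (continuousOn_const.mul hIYc)).sub hIhc
  have hΦd : ∀ t ∈ Ico 0 T,
      HasDerivWithinAt Φ (D t + 1 / 2 * Y t - h t) (Ici t) t := fun t ht =>
    ((hD t ht).add ((hIYd t ht).const_mul (1 / 2 : ℝ))).sub (hIhd t ht)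
  have hΦneg : ∀ t ∈ Ico 0 T, D t + 1 / 2 * Y t - h t ≤ 0 := by
    intro t ht
    have hWB : W t ≤ β ^ 2 := (hsup t ⟨ht.1, ht.2.le⟩).trans hLγδ.le
    have h1 := hineq'' t ht hWB
    have h2 : h t = 2 * K / T * W t + g t := rfl
    rw [h2]
    linarith
  have hΦT : Φ T ≤ Φ 0 := le_init_of_deriv_right_nonpos hT hΦc hΦd hΦneg
  have hΦ0 : Φ 0 = W 0 := by simp [hΦdef]
  have hΦT' : Φ T = W T + 1 / 2 * (∫ s in (0)..T, Y s) - ∫ s in (0)..T, h s := rfl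
  -- `∫₀ᵀ h ≤ 2K·(L γ δ²) + 2K²γδ²`
  have hWi : IntervalIntegrable W volume 0 T := hWc.intervalIntegrable_of_Icc hT.le
  have hgi : IntervalIntegrable g volume 0 T := hgc.intervalIntegrable_of_Icc hT.le
  have hIh : ∫ s in (0)..T, h s ≤ 2 * K * (L * γ * δ ^ 2) + 2 * K ^ 2 * γ * δ ^ 2 := by
    have eh : ∫ s in (0)..T, h s = 2 * K / T * (∫ s in (0)..T, W s) + ∫ s in (0)..T, g s := by
      simp only [hhdef]
      rw [intervalIntegral.integral_add (hWi.const_mul _) hgi, intervalIntegral.integral_const_mul]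
    have hIW : ∫ s in (0)..T, W s ≤ ∫ _ in (0)..T, L * γ * δ ^ 2 :=
      intervalIntegral.integral_mono_on hT.le hWi intervalIntegrable_const fun t ht => hsup t ht
    rw [intervalIntegral.integral_const, sub_zero, smul_eq_mul] at hIW
    have e1 : 2 * K / T * (∫ s in (0)..T, W s) ≤ 2 * K / T * (T * (L * γ * δ ^ 2)) :=
      mul_le_mul_of_nonneg_left hIW hκ.le
    have e2 : 2 * K / T * (T * (L * γ * δ ^ 2)) = 2 * K * (L * γ * δ ^ 2) := by
      field_simp
    rw [eh]
    linarith [hIg_le]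
  have hWT : 0 ≤ W T := hW0' T ⟨hT.le, le_rfl⟩
  have hY2 : ∫ s in (0)..T, Y s ≤
      2 * (K * δ ^ 2 + 2 * K * (L * γ * δ ^ 2) + 2 * K ^ 2 * γ * δ ^ 2) := by
    rw [hΦT', hΦ0] at hΦT
    linarith
  -- constants: `2(K + 2KLγ + 2K²γ) ≤ 6KLγ` since `γ ≥ 1` and `K + 2K² ≤ 3K² ≤ KL`
  have hδ2 : 0 < δ ^ 2 := pow_pos hδ 2
  have e1 : K * δ ^ 2 ≤ K * γ * δ ^ 2 :=
    mul_le_mul_of_nonneg_right (le_mul_of_one_le_right hK0.le hγ1) hδ2.le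
  have e2 : K + 2 * K ^ 2 ≤ K * L := by
    have h1 : K * (3 * K ^ 2) ≤ K * L := mul_le_mul_of_nonneg_left hK2L hK0.le
    have h2 : 3 * K ^ 2 ≤ K * (3 * K ^ 2) := le_mul_of_one_le_left (by positivity) hK
    linarith [hKK, h1, h2]
  have e3 : 2 * (K * γ * δ ^ 2 + 2 * K * (L * γ * δ ^ 2) + 2 * K ^ 2 * γ * δ ^ 2) ≤
      6 * K * L * γ * δ ^ 2 := by
    have hγδ : 0 < γ * δ ^ 2 := mul_pos hγ0 hδ2
    linarith [mul_le_mul_of_nonneg_right e2 hγδ.le]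
  calc ∫ s in (0)..T, Y s ≤ 2 * (K * δ ^ 2 + 2 * K * (L * γ * δ ^ 2) + 2 * K ^ 2 * γ * δ ^ 2) := hY2
    _ ≤ 2 * (K * γ * δ ^ 2 + 2 * K * (L * γ * δ ^ 2) + 2 * K ^ 2 * γ * δ ^ 2) := by linarith
    _ ≤ 6 * K * L * γ * δ ^ 2 := e3
    _ = 18 * K ^ 3 * Real.exp (2 * K) * c ^ (-(1 / 200 : ℝ)) * δ ^ 2 := by rw [hL, hγ]; ring

/-! ## Integrated form (for absolutely continuous `W`)

In §10 the localised enstrophy `W(t) = ½∫|ω|²η(t, x) dx` involves the shrinking radius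
`R'(t) = R' − c⁻¹∫₀ᵗ ‖u(s)‖_{L^∞} ds`, which is only absolutely continuous in `t` (the speed
`‖u(s)‖_{L^∞}` is merely integrable, Prop. 9.1); so the enstrophy inequality is naturally
available in *integrated* form `W(t) + ∫₀ᵗ Y₁ ≤ W(0) + ∫₀ᵗ (…)`, and we prove the
continuity-method step for that form as well. No derivative of `W` is needed: under the
bootstrap hypothesis on `[0, t]` the integrated inequality gives `W(t) ≤ H(t) := W(0) +
∫₀ᵗ (κW + g)`, and `H` is `C¹` with `H' = κW + g ≤ κH + g`, so Grönwall applies to `H`. -/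

/-- **Continuity method with Grönwall's inequality, integrated form.** Let `W` be continuous on
`[0, T]` with `W(0) ≥ 0`, `g ≥ 0` continuous on `[0, T]`, `κ > 0`. Suppose that for every
`t ∈ [0, T]` such that the bootstrap hypothesis `W ≤ B` holds on `[0, t]` one has the integral
inequality `W(t) ≤ W(0) + ∫₀ᵗ (κ W + g)`, and that `M = e^{κT}(W(0) + ∫₀ᵀ g) < B`. Then
`W(t) ≤ M` on `[0, T]`. [cite: Tao2011, §10, proof of Thm. 10.1 (continuity method)] -/
theorem bootstrap_gronwall_integral {T κ B : ℝ} (hT : 0 < T) (hκ : 0 < κ) {W g : ℝ → ℝ}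
    (hW : ContinuousOn W (Icc 0 T)) (hg : ContinuousOn g (Icc 0 T)) (hg0 : ∀ t ∈ Icc 0 T, 0 ≤ g t)
    (hW0 : 0 ≤ W 0)
    (hineq : ∀ t ∈ Icc 0 T, (∀ s ∈ Icc 0 t, W s ≤ B) →
      W t ≤ W 0 + ∫ s in (0)..t, (κ * W s + g s))
    (hM : Real.exp (κ * T) * (W 0 + ∫ s in (0)..T, g s) < B) :
    ∀ t ∈ Icc 0 T, W t ≤ Real.exp (κ * T) * (W 0 + ∫ s in (0)..T, g s) := by
  set Γ : ℝ := ∫ s in (0)..T, g s with hΓ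
  have hgi : IntervalIntegrable g volume 0 T := hg.intervalIntegrable_of_Icc hT.le
  have hΓ0 : 0 ≤ Γ := intervalIntegral.integral_nonneg hT.le fun s hs => hg0 s hs
  have hg_ae : 0 ≤ᵐ[volume.restrict (Ioc 0 T)] g :=
    (ae_restrict_iff' measurableSet_Ioc).2 (Eventually.of_forall fun s hs =>
      hg0 s (Ioc_subset_Icc_self hs))
  have hGle : ∀ t ∈ Icc 0 T, ∫ s in (0)..t, g s ≤ Γ := fun t ht =>
    integral_mono_interval le_rfl ht.1 ht.2 hg_ae hgi
  have hexp1 : 1 ≤ Real.exp (κ * T) := Real.one_le_exp (by positivity)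
  have hW0M : W 0 ≤ Real.exp (κ * T) * (W 0 + Γ) := by nlinarith
  -- Grönwall under the bootstrap hypothesis on `[0, t₁]`
  have claim : ∀ t₁ ∈ Icc 0 T, (∀ s ∈ Icc 0 t₁, W s ≤ B) →
      W t₁ ≤ Real.exp (κ * T) * (W 0 + Γ) := by
    intro t₁ ht₁ hB
    rcases ht₁.1.eq_or_lt with h0 | h0
    · rw [← h0]; exact hW0M
    -- `H = W(0) + ∫₀ᵗ (κW + g)` dominates `W` on `[0, t₁]` and is `C¹`
    have hφ : ContinuousOn (fun s => κ * W s + g s) (Icc 0 t₁) :=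
      ((continuousOn_const.mul hW).add hg).mono (Icc_subset_Icc le_rfl ht₁.2)
    obtain ⟨hHc, hHd⟩ := primitive_continuousOn_hasDerivWithinAt h0 hφ
    have hWH : ∀ t ∈ Icc 0 t₁, W t ≤ W 0 + ∫ s in (0)..t, (κ * W s + g s) := fun t ht =>
      hineq t ⟨ht.1, ht.2.trans ht₁.2⟩ fun s hs => hB s ⟨hs.1, hs.2.trans ht.2⟩
    set H : ℝ → ℝ := fun t => W 0 + ∫ s in (0)..t, (κ * W s + g s) with hHdef
    have hHc' : ContinuousOn H (Icc 0 t₁) := continuousOn_const.add hHc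
    have hHd' : ∀ t ∈ Ico 0 t₁, HasDerivWithinAt H (κ * W t + g t) (Ici t) t := fun t ht =>
      (hHd t ht).const_add (W 0)
    have hH0 : H 0 = W 0 := by simp [hHdef]
    have hgc₁ : ContinuousOn g (Icc 0 t₁) := hg.mono (Icc_subset_Icc le_rfl ht₁.2)
    have hg0₁ : ∀ t ∈ Icc 0 t₁, 0 ≤ g t := fun t ht => hg0 t ⟨ht.1, ht.2.trans ht₁.2⟩
    have hineqH : ∀ t ∈ Ico 0 t₁, H t ≤ Real.exp (κ * t₁) * (H 0 + ∫ s in (0)..t₁, g s) + 1 →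
        κ * W t + g t ≤ κ * H t + g t := by
      intro t ht _
      have := hWH t ⟨ht.1, ht.2.le⟩
      nlinarith
    have hMH : Real.exp (κ * t₁) * (H 0 + ∫ s in (0)..t₁, g s) <
        Real.exp (κ * t₁) * (H 0 + ∫ s in (0)..t₁, g s) + 1 := lt_add_one _
    have hgr := bootstrap_gronwall h0 hκ hHc' hHd' hgc₁ hg0₁ (by rw [hH0]; exact hW0) hineqH hMH
      t₁ ⟨h0.le, le_rfl⟩
    rw [hH0] at hgr
    have hexp : Real.exp (κ * t₁) ≤ Real.exp (κ * T) :=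
      Real.exp_le_exp.2 (mul_le_mul_of_nonneg_left ht₁.2 hκ.le)
    have hG₁ : ∫ s in (0)..t₁, g s ≤ Γ := hGle t₁ ht₁
    have hsum0 : 0 ≤ W 0 + ∫ s in (0)..t₁, g s := by
      have : 0 ≤ ∫ s in (0)..t₁, g s :=
        intervalIntegral.integral_nonneg h0.le fun s hs => hg0₁ s hs
      linarith
    calc W t₁ ≤ H t₁ := hWH t₁ ⟨h0.le, le_rfl⟩
      _ ≤ Real.exp (κ * t₁) * (W 0 + ∫ s in (0)..t₁, g s) := hgr
      _ ≤ Real.exp (κ * T) * (W 0 + ∫ s in (0)..t₁, g s) :=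
          mul_le_mul_of_nonneg_right hexp hsum0
      _ ≤ Real.exp (κ * T) * (W 0 + Γ) := by
          refine mul_le_mul_of_nonneg_left ?_ (Real.exp_pos _).le
          linarith
  -- the first bad time, if any
  by_cases hA : ∃ t ∈ Icc 0 T, B ≤ W t
  · exfalso
    set A : Set ℝ := Icc 0 T ∩ W ⁻¹' Ici B with hAdef
    have hAc : IsClosed A := hW.preimage_isClosed_of_isClosed isClosed_Icc isClosed_Ici
    have hAne : A.Nonempty := by
      obtain ⟨t, ht, hBt⟩ := hA
      exact ⟨t, ht, hBt⟩
    have hAbdd : BddBelow A := ⟨0, fun t ht => ht.1.1⟩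
    have ht₁A : sInf A ∈ A := hAc.csInf_mem hAne hAbdd
    have ht₁ : sInf A ∈ Icc 0 T := ht₁A.1
    have hlt : ∀ t ∈ Ico 0 (sInf A), W t ≤ B := by
      intro t ht
      by_contra hcon
      have htA : t ∈ A := ⟨⟨ht.1, (ht.2.le.trans ht₁.2)⟩, (not_le.1 hcon).le⟩
      exact absurd (csInf_le hAbdd htA) (not_le.2 ht.2)
    -- by continuity, `W ≤ B` on the closed interval `[0, sInf A]`
    have hle : ∀ t ∈ Icc 0 (sInf A), W t ≤ B := by
      rcases ht₁.1.eq_or_lt with h0 | h0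
      · -- `sInf A = 0`: then `B ≤ W 0 ≤ M < B`
        intro t ht
        exfalso
        have hB0 : B ≤ W 0 := by have := ht₁A.2; rwa [← h0] at this
        linarith
      have hC : IsClosed (Icc 0 T ∩ W ⁻¹' Iic B) :=
        hW.preimage_isClosed_of_isClosed isClosed_Icc isClosed_Iic
      have hsub : Ico 0 (sInf A) ⊆ Icc 0 T ∩ W ⁻¹' Iic B := fun t ht =>
        ⟨⟨ht.1, ht.2.le.trans ht₁.2⟩, hlt t ht⟩
      have hcl : closure (Ico 0 (sInf A)) ⊆ Icc 0 T ∩ W ⁻¹' Iic B := closure_minimal hsub hC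
      rw [closure_Ico h0.ne] at hcl
      exact fun t ht => (hcl ht).2
    have h1 := claim (sInf A) ht₁ hle
    have h2 : B ≤ W (sInf A) := ht₁A.2
    linarith
  · push Not at hA
    intro t ht
    exact claim t ht fun s hs => (hA s ⟨hs.1, hs.2.trans ht.2⟩).le

/-- The pointwise absorption step of the continuity method (real arithmetic): with
`γ = c^{-1/200}`, under `K c^{9/200} ≤ ½`, `c^{1/20}γ = c^{9/200}`, `c^{-3/20}γc ≤ 1`,
`c^{3/4} ≤ 1`, `δ⁴ ≤ c/T` and the bootstrap bound `w ≤ (γδ)²` one has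
`K(c^{1/20}δ⁻¹√w·y + c^{-3/20}δ³w√w + c^{3/4}w/T + α√w + b) ≤ ½y + (2K/T)w + K(γδα + b)`. [cite: Tao2011, §10, proof of Thm. 10.1 (continuity method)] -/
theorem tao2011_absorb {K c γ δ T w y α b : ℝ} (hK0 : 0 < K) (hT : 0 < T) (hδ : 0 < δ)
    (hγ0 : 0 < γ) (hc0 : 0 ≤ c ^ (1 / 20 : ℝ)) (hc3 : 0 ≤ c ^ (-(3 / 20 : ℝ)))
    (hKc : K * c ^ (9 / 200 : ℝ) ≤ 1 / 2)
    (hexpA : c ^ (1 / 20 : ℝ) * γ = c ^ (9 / 200 : ℝ)) (hexpB : c ^ (-(3 / 20 : ℝ)) * γ * c ≤ 1)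
    (hexpC : c ^ (3 / 4 : ℝ) ≤ 1) (hδ4 : δ ^ 4 ≤ c / T)
    (hw : 0 ≤ w) (hy : 0 ≤ y) (hα : 0 ≤ α) (hwB : w ≤ (γ * δ) ^ 2) :
    K * (c ^ (1 / 20 : ℝ) * δ⁻¹ * Real.sqrt w * y + c ^ (-(3 / 20 : ℝ)) * δ ^ 3 * (w * Real.sqrt w) +
        c ^ (3 / 4 : ℝ) * w / T + α * Real.sqrt w + b) ≤
      1 / 2 * y + 2 * K / T * w + K * (γ * δ * α + b) := by
  set β : ℝ := γ * δ with hβ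
  have hβ0 : 0 < β := mul_pos hγ0 hδ
  have hs : Real.sqrt w ≤ β := sqrt_le_of_le_sq hβ0.le hwB
  have hs0 : 0 ≤ Real.sqrt w := Real.sqrt_nonneg _
  -- term 1
  have h1 : K * (c ^ (1 / 20 : ℝ) * δ⁻¹ * Real.sqrt w * y) ≤ 1 / 2 * y := by
    have e1 : c ^ (1 / 20 : ℝ) * δ⁻¹ * Real.sqrt w ≤ c ^ (9 / 200 : ℝ) := by
      calc c ^ (1 / 20 : ℝ) * δ⁻¹ * Real.sqrt w ≤ c ^ (1 / 20 : ℝ) * δ⁻¹ * β :=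
            mul_le_mul_of_nonneg_left hs (by positivity)
        _ = c ^ (9 / 200 : ℝ) := by rw [hβ, ← hexpA]; field_simp
    calc K * (c ^ (1 / 20 : ℝ) * δ⁻¹ * Real.sqrt w * y)
        = K * (c ^ (1 / 20 : ℝ) * δ⁻¹ * Real.sqrt w) * y := by ring
      _ ≤ K * c ^ (9 / 200 : ℝ) * y := by
          have := mul_le_mul_of_nonneg_left e1 hK0.le
          exact mul_le_mul_of_nonneg_right (by linarith) hy
      _ ≤ 1 / 2 * y := mul_le_mul_of_nonneg_right hKc hy
  -- term 2
  have h2 : K * (c ^ (-(3 / 20 : ℝ)) * δ ^ 3 * (w * Real.sqrt w)) ≤ K * w / T := by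
    have e1 : w * Real.sqrt w ≤ w * β := mul_le_mul_of_nonneg_left hs hw
    have e2 : c ^ (-(3 / 20 : ℝ)) * δ ^ 3 * (w * β) = (c ^ (-(3 / 20 : ℝ)) * γ) * δ ^ 4 * w := by
      rw [hβ]; ring
    have hcg : 0 ≤ c ^ (-(3 / 20 : ℝ)) * γ := by positivity
    have e3 : (c ^ (-(3 / 20 : ℝ)) * γ) * δ ^ 4 * w ≤ (c ^ (-(3 / 20 : ℝ)) * γ) * (c / T) * w :=
      mul_le_mul_of_nonneg_right (mul_le_mul_of_nonneg_left hδ4 hcg) hw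
    have e4 : (c ^ (-(3 / 20 : ℝ)) * γ) * (c / T) * w = (c ^ (-(3 / 20 : ℝ)) * γ * c) * (w / T) := by
      ring
    have e5 : (c ^ (-(3 / 20 : ℝ)) * γ * c) * (w / T) ≤ 1 * (w / T) :=
      mul_le_mul_of_nonneg_right hexpB (div_nonneg hw hT.le)
    calc K * (c ^ (-(3 / 20 : ℝ)) * δ ^ 3 * (w * Real.sqrt w))
        ≤ K * (c ^ (-(3 / 20 : ℝ)) * δ ^ 3 * (w * β)) :=
          mul_le_mul_of_nonneg_left (mul_le_mul_of_nonneg_left e1 (by positivity)) hK0.le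
      _ ≤ K * (1 * (w / T)) := by
          rw [e2]
          exact mul_le_mul_of_nonneg_left (e3.trans (by rw [e4]; exact e5)) hK0.le
      _ = K * w / T := by ring
  -- term 3
  have h3 : K * (c ^ (3 / 4 : ℝ) * w / T) ≤ K * w / T := by
    have : c ^ (3 / 4 : ℝ) * w / T ≤ 1 * w / T := by
      rw [mul_div_assoc, mul_div_assoc]
      exact mul_le_mul_of_nonneg_right hexpC (div_nonneg hw hT.le)
    calc K * (c ^ (3 / 4 : ℝ) * w / T) ≤ K * (1 * w / T) := mul_le_mul_of_nonneg_left this hK0.le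
      _ = K * w / T := by ring
  -- term 4
  have h4 : K * (α * Real.sqrt w) ≤ K * (γ * δ * α) := by
    refine mul_le_mul_of_nonneg_left ?_ hK0.le
    calc α * Real.sqrt w ≤ α * β := mul_le_mul_of_nonneg_left hs hα
      _ = γ * δ * α := by rw [hβ]; ring
  have hKwT : K * w / T = K / T * w := by ring
  have hsum := add_le_add (add_le_add (add_le_add (add_le_add h1 h2) h3) h4) (le_refl (K * b))
  calc K * (c ^ (1 / 20 : ℝ) * δ⁻¹ * Real.sqrt w * y + c ^ (-(3 / 20 : ℝ)) * δ ^ 3 * (w * Real.sqrt w) +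
        c ^ (3 / 4 : ℝ) * w / T + α * Real.sqrt w + b)
      = K * (c ^ (1 / 20 : ℝ) * δ⁻¹ * Real.sqrt w * y) +
          K * (c ^ (-(3 / 20 : ℝ)) * δ ^ 3 * (w * Real.sqrt w)) + K * (c ^ (3 / 4 : ℝ) * w / T) +
          K * (α * Real.sqrt w) + K * b := by ring
    _ ≤ 1 / 2 * y + K * w / T + K * w / T + K * (γ * δ * α) + K * b := hsum
    _ = 1 / 2 * y + 2 * K / T * w + K * (γ * δ * α + b) := by rw [hKwT]; ring

/-- **Tao 2011, proof of Thm. 10.1 — the continuity-method step, integrated form.** As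
`tao2011_enstrophy_continuity_step`, but with the enstrophy inequality in the integrated form
`W(t) + ∫₀ᵗ Y ≤ W(0) + ∫₀ᵗ K(c^{0.05}δ⁻¹W^{1/2}Y + c^{-0.15}δ³W^{3/2} + c^{0.75}W/T + aW^{1/2} + b)`
for all `t ∈ [0, T]` (`W, Y, a, b ≥ 0` continuous on `[0, T]`; no differentiability of `W`),
which is the form available when the cutoff radius `R'(t) = R' − c⁻¹∫₀ᵗ‖u‖_{L^∞}` is only
absolutely continuous. Conclusion: `sup_{[0,T]} W ≤ 3K²e^{2K}c^{-0.005}δ²` and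
`∫₀ᵀ Y ≤ 18K³e^{2K}c^{-0.005}δ²`, for `0 < c ≤ c₀(K)`, `δ⁴T ≤ c`, `W(0) ≤ Kδ²`, `∫₀ᵀ a ≤ Kδ`,
`∫₀ᵀ b ≤ Kδ²`. Proof: under the bootstrap hypothesis on `[0, t]` the integrand is at most
`½Y + 2KW/T + K(c^{-0.005}δa + b)` (`tao2011_absorb`), whence
`W(t) + ½∫₀ᵗY ≤ W(0) + ∫₀ᵗ(2KW/T + g)`; `bootstrap_gronwall_integral` bounds `W`, and then
`t = T` bounds `∫₀ᵀ Y`. [cite: Tao2011, §10, proof of Thm. 10.1 (continuity method)] -/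
theorem tao2011_enstrophy_continuity_step_integral {K : ℝ} (hK : 1 ≤ K) :
    ∃ c₀ : ℝ, 0 < c₀ ∧ c₀ ≤ 1 ∧ ∀ ⦃c δ T : ℝ⦄, 0 < c → c ≤ c₀ → 0 < δ → 0 < T → δ ^ 4 * T ≤ c →
    ∀ ⦃W Y a b : ℝ → ℝ⦄, ContinuousOn W (Icc 0 T) → ContinuousOn Y (Icc 0 T) →
      ContinuousOn a (Icc 0 T) → ContinuousOn b (Icc 0 T) →
      (∀ t ∈ Icc 0 T, 0 ≤ W t) → (∀ t ∈ Icc 0 T, 0 ≤ Y t) →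
      (∀ t ∈ Icc 0 T, 0 ≤ a t) → (∀ t ∈ Icc 0 T, 0 ≤ b t) →
      W 0 ≤ K * δ ^ 2 → (∫ t in (0)..T, a t) ≤ K * δ → (∫ t in (0)..T, b t) ≤ K * δ ^ 2 →
      (∀ t ∈ Icc 0 T, W t + ∫ s in (0)..t, Y s ≤ W 0 + ∫ s in (0)..t,
          K * (c ^ (1 / 20 : ℝ) * δ⁻¹ * Real.sqrt (W s) * Y s +
            c ^ (-(3 / 20 : ℝ)) * δ ^ 3 * (W s * Real.sqrt (W s)) + c ^ (3 / 4 : ℝ) * W s / T +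
            a s * Real.sqrt (W s) + b s)) →
      (∀ t ∈ Icc 0 T, W t ≤ 3 * K ^ 2 * Real.exp (2 * K) * c ^ (-(1 / 200 : ℝ)) * δ ^ 2) ∧
        (∫ t in (0)..T, Y t) ≤ 18 * K ^ 3 * Real.exp (2 * K) * c ^ (-(1 / 200 : ℝ)) * δ ^ 2 := by
  -- constants, exactly as in `tao2011_enstrophy_continuity_step`
  set L : ℝ := 3 * K ^ 2 * Real.exp (2 * K) with hL
  have hK0 : 0 < K := one_pos.trans_le hK
  have hexp1 : 1 ≤ Real.exp (2 * K) := Real.one_le_exp (by positivity)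
  have hK2L : 3 * K ^ 2 ≤ L := by
    rw [hL]
    nlinarith [mul_le_mul_of_nonneg_left hexp1 (by positivity : (0 : ℝ) ≤ 3 * K ^ 2)]
  have hKK : K ≤ K ^ 2 := by nlinarith
  have hLK : K ≤ L := by linarith [hKK, hK2L, sq_nonneg K]
  have hL1 : 1 ≤ L := hK.trans hLK
  have hL0 : 0 < L := one_pos.trans_le hL1
  have h2L : 1 ≤ 2 * L := by linarith
  refine ⟨(2 * L) ^ (-(200 : ℝ)), Real.rpow_pos_of_pos (by positivity) _,
    Real.rpow_le_one_of_one_le_of_nonpos h2L (by norm_num), ?_⟩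
  intro c δ T hc hcc₀ hδ hT hδT W Y a b hWc hYc hac hbc hW0' hY0 ha0 hb0 hW0 hIa hIb hineq
  have hc1 : c ≤ 1 := hcc₀.trans (Real.rpow_le_one_of_one_le_of_nonpos h2L (by norm_num))
  have hroot : c ^ (1 / 200 : ℝ) ≤ (2 * L)⁻¹ := by
    calc c ^ (1 / 200 : ℝ) ≤ ((2 * L) ^ (-(200 : ℝ))) ^ (1 / 200 : ℝ) :=
          Real.rpow_le_rpow hc.le hcc₀ (by norm_num)
      _ = (2 * L)⁻¹ := by
          rw [← Real.rpow_mul (by positivity), show (-(200 : ℝ)) * (1 / 200) = -1 by norm_num,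
            Real.rpow_neg_one]
  have hroot0 : 0 < c ^ (1 / 200 : ℝ) := Real.rpow_pos_of_pos hc _
  set γ : ℝ := c ^ (-(1 / 200 : ℝ)) with hγ
  have hγinv : γ = (c ^ (1 / 200 : ℝ))⁻¹ := by rw [hγ, Real.rpow_neg hc.le]
  have hγ1 : 1 ≤ γ := Real.one_le_rpow_of_pos_of_le_one_of_nonpos hc hc1 (by norm_num)
  have hγ0 : 0 < γ := one_pos.trans_le hγ1
  have hLγ : L < γ := by
    rw [hγinv, lt_inv_comm₀ hL0 hroot0]
    calc c ^ (1 / 200 : ℝ) ≤ (2 * L)⁻¹ := hroot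
      _ < L⁻¹ := by
          rw [inv_lt_inv₀ (by positivity) hL0]
          linarith
  have hKc : K * c ^ (9 / 200 : ℝ) ≤ 1 / 2 := by
    have h9 : c ^ (9 / 200 : ℝ) = (c ^ (1 / 200 : ℝ)) ^ (9 : ℕ) := by
      rw [← Real.rpow_mul_natCast hc.le]; norm_num
    have h1 : c ^ (1 / 200 : ℝ) ≤ 1 := Real.rpow_le_one hc.le hc1 (by norm_num)
    have h2 : (c ^ (1 / 200 : ℝ)) ^ (9 : ℕ) ≤ c ^ (1 / 200 : ℝ) :=
      pow_le_of_le_one hroot0.le h1 (by norm_num)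
    have h3 : K * (2 * L)⁻¹ ≤ 1 / 2 := by
      rw [mul_inv_le_iff₀ (by positivity)]; linarith
    calc K * c ^ (9 / 200 : ℝ) ≤ K * c ^ (1 / 200 : ℝ) := by
          rw [h9]; exact mul_le_mul_of_nonneg_left h2 hK0.le
      _ ≤ K * (2 * L)⁻¹ := mul_le_mul_of_nonneg_left hroot hK0.le
      _ ≤ 1 / 2 := h3
  have hexpA : c ^ (1 / 20 : ℝ) * γ = c ^ (9 / 200 : ℝ) := by
    rw [hγ, ← Real.rpow_add hc]; norm_num
  have hexpB : c ^ (-(3 / 20 : ℝ)) * γ * c ≤ 1 := by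
    rw [hγ, ← Real.rpow_add hc, ← Real.rpow_add_one hc.ne']
    exact Real.rpow_le_one hc.le hc1 (by norm_num)
  have hexpC : c ^ (3 / 4 : ℝ) ≤ 1 := Real.rpow_le_one hc.le hc1 (by norm_num)
  have hδ4 : δ ^ 4 ≤ c / T := by rw [le_div_iff₀ hT]; exact hδT
  have hc20 : 0 ≤ c ^ (1 / 20 : ℝ) := (Real.rpow_pos_of_pos hc _).le
  have hc320 : 0 ≤ c ^ (-(3 / 20 : ℝ)) := (Real.rpow_pos_of_pos hc _).le
  -- the forcing `g = K(γδa + b)` and `κ = 2K/T`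
  set g : ℝ → ℝ := fun t => K * (γ * δ * a t + b t) with hgdef
  have hgc : ContinuousOn g (Icc 0 T) :=
    continuousOn_const.mul ((continuousOn_const.mul hac).add hbc)
  have hg0 : ∀ t ∈ Icc 0 T, 0 ≤ g t := fun t ht => by
    have := ha0 t ht; have := hb0 t ht; positivity
  have hai : IntervalIntegrable a volume 0 T := hac.intervalIntegrable_of_Icc hT.le
  have hbi : IntervalIntegrable b volume 0 T := hbc.intervalIntegrable_of_Icc hT.le
  have hIg : ∫ t in (0)..T, g t = K * (γ * δ * (∫ t in (0)..T, a t) + ∫ t in (0)..T, b t) := by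
    simp only [hgdef]
    rw [intervalIntegral.integral_const_mul, intervalIntegral.integral_add (hai.const_mul _) hbi,
      intervalIntegral.integral_const_mul]
  have hIg_le : ∫ t in (0)..T, g t ≤ 2 * K ^ 2 * γ * δ ^ 2 := by
    rw [hIg]
    have e1 : γ * δ * (∫ t in (0)..T, a t) ≤ γ * δ * (K * δ) :=
      mul_le_mul_of_nonneg_left hIa (by positivity)
    have e2 : K * δ ^ 2 ≤ K * δ ^ 2 * γ := le_mul_of_one_le_right (by positivity) hγ1
    nlinarith [mul_le_mul_of_nonneg_left (add_le_add e1 hIb) hK0.le]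
  have hκ : 0 < 2 * K / T := by positivity
  have hκT : 2 * K / T * T = 2 * K := by field_simp
  have hMle : Real.exp (2 * K / T * T) * (W 0 + ∫ t in (0)..T, g t) ≤ L * γ * δ ^ 2 := by
    rw [hκT, hL]
    have e1 : W 0 + ∫ t in (0)..T, g t ≤ 3 * K ^ 2 * γ * δ ^ 2 := by
      have e2 : K * δ ^ 2 ≤ K ^ 2 * γ * δ ^ 2 := by
        have : K ≤ K ^ 2 * γ := by nlinarith [mul_le_mul hK hγ1 zero_le_one hK0.le]
        exact mul_le_mul_of_nonneg_right this (by positivity)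
      linarith [hW0, hIg_le]
    calc Real.exp (2 * K) * (W 0 + ∫ t in (0)..T, g t)
        ≤ Real.exp (2 * K) * (3 * K ^ 2 * γ * δ ^ 2) :=
          mul_le_mul_of_nonneg_left e1 (Real.exp_pos _).le
      _ = 3 * K ^ 2 * Real.exp (2 * K) * γ * δ ^ 2 := by ring
  have hLγδ : L * γ * δ ^ 2 < (γ * δ) ^ 2 := by
    rw [mul_pow, sq γ]
    exact mul_lt_mul_of_pos_right (mul_lt_mul_of_pos_right hLγ hγ0) (pow_pos hδ 2)
  have hMlt : Real.exp (2 * K / T * T) * (W 0 + ∫ t in (0)..T, g t) < (γ * δ) ^ 2 :=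
    hMle.trans_lt hLγδ
  have hW00 : 0 ≤ W 0 := hW0' 0 ⟨le_rfl, hT.le⟩
  -- the two integrands: Tao's `Φ` and the absorbed `ψ = ½Y + (2K/T)W + g`
  set Φ : ℝ → ℝ := fun s => K * (c ^ (1 / 20 : ℝ) * δ⁻¹ * Real.sqrt (W s) * Y s +
      c ^ (-(3 / 20 : ℝ)) * δ ^ 3 * (W s * Real.sqrt (W s)) + c ^ (3 / 4 : ℝ) * W s / T +
      a s * Real.sqrt (W s) + b s) with hΦdef
  set ψ : ℝ → ℝ := fun s => 1 / 2 * Y s + 2 * K / T * W s + g s with hψdef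
  have hsqc : ContinuousOn (fun s => Real.sqrt (W s)) (Icc 0 T) :=
    Real.continuous_sqrt.comp_continuousOn hWc
  have hΦc : ContinuousOn Φ (Icc 0 T) := by
    simp only [hΦdef]
    refine continuousOn_const.mul ((((?_ : ContinuousOn _ _).add ?_).add ?_).add ?_ |>.add hbc)
    · exact ((continuousOn_const.mul hsqc).mul hYc)
    · exact continuousOn_const.mul (hWc.mul hsqc)
    · exact (continuousOn_const.mul hWc).div_const _
    · exact hac.mul hsqc
  have hψc : ContinuousOn ψ (Icc 0 T) :=
    ((continuousOn_const.mul hYc).add (continuousOn_const.mul hWc)).add hgc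
  -- under the bootstrap hypothesis on `[0, t]`: `W t + ½∫₀ᵗ Y ≤ W 0 + ∫₀ᵗ (κ W + g)`
  have hWi : IntervalIntegrable W volume 0 T := hWc.intervalIntegrable_of_Icc hT.le
  have hYi : IntervalIntegrable Y volume 0 T := hYc.intervalIntegrable_of_Icc hT.le
  have hgi : IntervalIntegrable g volume 0 T := hgc.intervalIntegrable_of_Icc hT.le
  have habs : ∀ t ∈ Icc 0 T, (∀ s ∈ Icc 0 t, W s ≤ (γ * δ) ^ 2) →
      W t + 1 / 2 * (∫ s in (0)..t, Y s) ≤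
        W 0 + ∫ s in (0)..t, (2 * K / T * W s + g s) := by
    intro t ht hB
    have hsub : Icc 0 t ⊆ Icc 0 T := Icc_subset_Icc le_rfl ht.2
    have hΦi : IntervalIntegrable Φ volume 0 t := (hΦc.mono hsub).intervalIntegrable_of_Icc ht.1
    have hψi : IntervalIntegrable ψ volume 0 t := (hψc.mono hsub).intervalIntegrable_of_Icc ht.1
    have hmono : ∫ s in (0)..t, Φ s ≤ ∫ s in (0)..t, ψ s := by
      refine intervalIntegral.integral_mono_on ht.1 hΦi hψi fun s hs => ?_
      have hsT : s ∈ Icc 0 T := hsub hs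
      simp only [hΦdef, hψdef, hgdef]
      exact tao2011_absorb hK0 hT hδ hγ0 hc20 hc320 hKc hexpA hexpB hexpC hδ4 (hW0' s hsT)
        (hY0 s hsT) (ha0 s hsT) (hB s hs)
    have hsplit : ∫ s in (0)..t, ψ s =
        1 / 2 * (∫ s in (0)..t, Y s) + ∫ s in (0)..t, (2 * K / T * W s + g s) := by
      have hYit : IntervalIntegrable Y volume 0 t := hYi.mono_set (by
        rw [uIcc_of_le hT.le, uIcc_of_le ht.1]; exact hsub)
      have hWit : IntervalIntegrable W volume 0 t := hWi.mono_set (by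
        rw [uIcc_of_le hT.le, uIcc_of_le ht.1]; exact hsub)
      have hgit : IntervalIntegrable g volume 0 t := hgi.mono_set (by
        rw [uIcc_of_le hT.le, uIcc_of_le ht.1]; exact hsub)
      simp only [hψdef]
      rw [intervalIntegral.integral_add ((hYit.const_mul _).add (hWit.const_mul _)) hgit,
        intervalIntegral.integral_add (hYit.const_mul _) (hWit.const_mul _),
        intervalIntegral.integral_const_mul,
        intervalIntegral.integral_add (hWit.const_mul _) hgit]
      ring
    have h1 := hineq t ht
    have h2 : W t + ∫ s in (0)..t, Y s ≤ W 0 + ∫ s in (0)..t, ψ s := h1.trans (by linarith)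
    rw [hsplit] at h2
    linarith
  have hineq' : ∀ t ∈ Icc 0 T, (∀ s ∈ Icc 0 t, W s ≤ (γ * δ) ^ 2) →
      W t ≤ W 0 + ∫ s in (0)..t, (2 * K / T * W s + g s) := by
    intro t ht hB
    have h1 := habs t ht hB
    have h2 : 0 ≤ ∫ s in (0)..t, Y s :=
      intervalIntegral.integral_nonneg ht.1 fun s hs => hY0 s (Icc_subset_Icc le_rfl ht.2 hs)
    linarith
  -- (i) the sup bound
  have hsup : ∀ t ∈ Icc 0 T, W t ≤ L * γ * δ ^ 2 := fun t ht =>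
    (bootstrap_gronwall_integral hT hκ hWc hgc hg0 hW00 hineq' hMlt t ht).trans hMle
  refine ⟨fun t ht => (hsup t ht).trans_eq (by rw [hL, hγ]), ?_⟩
  -- (ii) the dissipation bound, from `habs` at `t = T`
  have hT' : T ∈ Icc 0 T := ⟨hT.le, le_rfl⟩
  have hfull := habs T hT' fun s hs => (hsup s hs).trans hLγδ.le
  have hIh : ∫ s in (0)..T, (2 * K / T * W s + g s) ≤
      2 * K * (L * γ * δ ^ 2) + 2 * K ^ 2 * γ * δ ^ 2 := by
    rw [intervalIntegral.integral_add (hWi.const_mul _) hgi, intervalIntegral.integral_const_mul]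
    have hIW : ∫ s in (0)..T, W s ≤ ∫ _ in (0)..T, L * γ * δ ^ 2 :=
      intervalIntegral.integral_mono_on hT.le hWi intervalIntegrable_const fun t ht => hsup t ht
    rw [intervalIntegral.integral_const, sub_zero, smul_eq_mul] at hIW
    have e1 : 2 * K / T * (∫ s in (0)..T, W s) ≤ 2 * K / T * (T * (L * γ * δ ^ 2)) :=
      mul_le_mul_of_nonneg_left hIW hκ.le
    have e2 : 2 * K / T * (T * (L * γ * δ ^ 2)) = 2 * K * (L * γ * δ ^ 2) := by
      field_simp
    linarith [hIg_le]
  have hWT : 0 ≤ W T := hW0' T hT'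
  have hY2 : ∫ s in (0)..T, Y s ≤
      2 * (K * δ ^ 2 + 2 * K * (L * γ * δ ^ 2) + 2 * K ^ 2 * γ * δ ^ 2) := by linarith
  have hδ2 : 0 < δ ^ 2 := pow_pos hδ 2
  have e1 : K * δ ^ 2 ≤ K * γ * δ ^ 2 :=
    mul_le_mul_of_nonneg_right (le_mul_of_one_le_right hK0.le hγ1) hδ2.le
  have e2 : K + 2 * K ^ 2 ≤ K * L := by
    have h1 : K * (3 * K ^ 2) ≤ K * L := mul_le_mul_of_nonneg_left hK2L hK0.le
    have h2 : 3 * K ^ 2 ≤ K * (3 * K ^ 2) := le_mul_of_one_le_left (by positivity) hK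
    linarith [hKK, h1, h2]
  have e3 : 2 * (K * γ * δ ^ 2 + 2 * K * (L * γ * δ ^ 2) + 2 * K ^ 2 * γ * δ ^ 2) ≤
      6 * K * L * γ * δ ^ 2 := by
    have hγδ : 0 < γ * δ ^ 2 := mul_pos hγ0 hδ2
    linarith [mul_le_mul_of_nonneg_right e2 hγδ.le]
  calc ∫ s in (0)..T, Y s ≤ 2 * (K * δ ^ 2 + 2 * K * (L * γ * δ ^ 2) + 2 * K ^ 2 * γ * δ ^ 2) := hY2
    _ ≤ 2 * (K * γ * δ ^ 2 + 2 * K * (L * γ * δ ^ 2) + 2 * K ^ 2 * γ * δ ^ 2) := by linarith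
    _ ≤ 6 * K * L * γ * δ ^ 2 := e3
    _ = 18 * K ^ 3 * Real.exp (2 * K) * c ^ (-(1 / 200 : ℝ)) * δ ^ 2 := by rw [hL, hγ]; ring

end Literature.Analysis.FluidPDE

end
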